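import Summits.BirchSwinnertonDyer.Rank1Residual.X12.ClassClosureO10RubinEta
import Summits.BirchSwinnertonDyer.Rank1Residual.X12.InertCoreEveryCurveDeuringFree
import HarnessLib

/-!
# Class X12, residual class O10 (CM, `r_an = 1`, `p ≥ 5` inert and bad): the class target per
# signed local type is EXACTLY `BSD_p` on the type at `p ≥ 11` — no Manin datum, no Deuring binder

HONEST FRAMING (cell `b2b-bsdres`, run/shared/lean/b2b/bsd-rank1-residual/, verbatim in every
file): the goal of the cell is to DELETE the COMBINATION-SHAPED residual classes of the
Birch–Swinnerton-Dyer formula for ALL analytic-rank `≤ 1` elliptic curves over `ℚ` — "full BSD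
formula for every rank `≤ 1` curve in class `C`" assembled STRICTLY from published theorems — so
that the rank-`≤ 1` remainder becomes exactly the CONSTRUCTION-SHAPED classes, which are TYPED
(missing-input `Prop`s), NOT attempted. This is not "finishing BSD". Class X12 / residual class O10
is CONSTRUCTION-SHAPED and stays so; the class target `O10.LowerHalfOnType p T` is OPEN (an
`@[conjecture]` obligation of `ClassClosureO10RubinEta.lean`, cc-typer-6); this file is
bookkeeping by the off-peak literature seat `b2b-bsdres-lit-bst` (gen 11); no claim beyond the
stated class; nothing here is booked.

WHAT THIS FILE DOES. `ClassClosureO10RubinEta.lean` (§Consumers) turns the class target on a signed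
local type `(p, T)` into `BSD(E,p)` per pair MODULO a Manin datum `p ∤ c(D)` (`p ≥ 5`), or for the
STRONG curve with an optimal datum and the Deuring binder `hDeu` (`p ≥ 11`). Two inputs have
since become theorems of the tree: Deuring's criterion
(`deuring_not_hasUnitRootAt_of_hasCM_of_not_cmSplit_holds`, p253190) and x1b gen 19's every-curve
upper half (`X12/InertCoreEveryCurve.lean`, `hDeu`-free in
`X12/InertCoreEveryCurveDeuringFree.lean`, p254097: Modularity supplies the optimal member,
Cassels' isogeny invariance moves the one-sided halves). Hence, at `p ≥ 11`:
* `bsdp_of_lowerHalfOnType_of_optimal'` — the strong-curve consumer WITHOUT `hDeu`;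
* `bsdp_of_lowerHalfOnType_of_seven_lt` — `LowerHalfOnType p T ⟹ BSD(W,p)` for EVERY globally
  minimal `W` of signed local type `(p, T)` with `r_an(W) = 1`: NO Manin datum, NO optimality,
  NO `NeZero` conductor instance, NO Deuring binder — binders = published named facts
  (Gross–Zagier, Kolyvagin, Matar–Nekovář 2019 Thm. 0.3, GZK, modularity `hmod`/`hnf`,
  Friedberg–Hoffstein, the rank-0 CM triple, Edixhoven 1991 Thm. 3, Cassels) and the typed target;
* `lowerHalfOnType_iff_forall_bsdp_of_seven_lt` — with cc-typer-6's converse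
  `lowerHalfOnType_of_forall_bsdp`: **at `p ≥ 11` the O10 class target on a type is EXACTLY
  "`BSD(W,p)` for every rank-one CM curve of signed local type `(p, T)`"**, neither weaker nor
  stronger, with no auxiliary datum (cc-typer-6's reading "modulo the Manin datum" loses the
  proviso at `p ≥ 11`; at `p ∈ {5, 7}` Edixhoven's `p > 7` keeps the Manin datum, per pair from
  Cremona's table as before).
READING (no label change): O10 stays OPEN/CONSTRUCTION-SHAPED; this only sharpens what closing
the typed target would buy.

References: B. Edixhoven, Progr. Math. 89 (1991) 25–39, Thm. 3 [EdixhovenManin1991]; S. Lang,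
*Elliptic Functions* (GTM 112, 1987) Ch. 13 §4 Thm. 12 [Lang1987]; A. Matar, J. Nekovář, JTNB 31
(2019) Thm. 0.3, §0.11 [MatarNekovar2019]; J. S. Milne, *Arithmetic Duality Theorems* (2006)
Thm. I.7.3 [MilneADT2006]; R. L. Miller, LMS J. Comput. Math. 14 (2011) Def. 1.1 [Miller2011LMS];
HOME `b2b-bsdres-lit-bst/BST-BCST.md` §15; `class-closure/` §3.14 (O10).
-/

noncomputable section

open scoped Classical NumberField

open WeierstrassCurve NumberField IsDedekindDomain Literature.NumberTheory.EllipticCurves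
  Literature.NumberTheory.EllipticCurves.ModularForms
  Literature.NumberTheory.EllipticCurves.Rank1Residual
  Literature.NumberTheory.EllipticCurves.Rank1Residual.Typed
  Literature.NumberTheory.Automorphic
  Literature.NumberTheory.DiophantineGeometry

namespace Summit.BirchSwinnertonDyer.Rank1Residual.X12.O10

variable {p : ℕ} [hp : Fact p.Prime] {T : KodairaSymbol}

/-- **`hDeu`-free form of `bsdp_of_lowerHalfOnType_of_optimal`** — the same statement with the
binder `(hDeu : deuring_not_hasUnitRootAt_of_hasCM_of_not_cmSplit)` REMOVED: Deuring's criterion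
(supersingular half) is the tree theorem `deuring_not_hasUnitRootAt_of_hasCM_of_not_cmSplit_holds`
(p253190); proof = the original applied to it. [cite: EdixhovenManin1991, Thm. 3]
[cite: MatarNekovar2019, Thm. 0.3 and §0.11] [cite: Lang1987, Ch. 13 §4 Thm. 12] -/
theorem bsdp_of_lowerHalfOnType_of_optimal'
    (hGZ : ∀ (N : ℕ) [NeZero N] (W : WeierstrassCurve ℚ) (K : Type) [Field K] [NumberField K],
      gross_zagier N W K)
    (hKo : ∀ (N : ℕ) [NeZero N] (W : WeierstrassCurve ℚ) (K : Type) [Field K] [NumberField K],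
      kolyvagin N W K)
    (hMN : ∀ (N : ℕ) [NeZero N] (W : WeierstrassCurve ℚ) (K : Type) [Field K] [NumberField K],
      MatarNekovar2019.thm03_padicValNat_card_sha_le_of_irreducible N W K)
    (hGZK : rank_eq_analyticRank_of_analyticRank_le_one) (hmod : hasEntireLFunction_rat)
    (hnf : exists_isNewformOf) (hFH : friedbergHoffstein_exists_heegnerField_split_twist_ne_zero)
    (hCM8 : bsdTriple_of_hasCM_of_L_one_ne_zero)
    (hEdx : edixhoven_not_dvd_maninConstant_of_not_potentiallyGoodOrdinary)
    (h : LowerHalfOnType p T)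
    (W : WeierstrassCurve ℚ) [W.IsElliptic] [W.IsGloballyMinimal] [NeZero (W.conductorNorm ℤ)]
    (hT : HasSignedLocalType W p T) (hr : W.analyticRank = 1) (hp11 : 7 < p)
    (D : ModularParametrizationData W (W.conductorNorm ℤ))
    (hopt : ∀ z ∈ D.L.lattice, ∃ w ∈ periodLattice D.f, z = D.c * w) : BSDp W p :=
  bsdp_of_lowerHalfOnType_of_optimal hGZ hKo hMN hGZK hmod hnf hFH hCM8 hEdx
    deuring_not_hasUnitRootAt_of_hasCM_of_not_cmSplit_holds h W hT hr hp11 D hopt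

/-- **`LowerHalfOnType p T ⟹ BSD(W,p)` for EVERY rank-one CM curve of signed local type `(p, T)`,
`p ≥ 11` — NO Manin datum, NO optimality hypothesis, NO Deuring binder.** From x1b gen 19's
every-curve assembly in its `hDeu`-free form `bsdp_of_classX12_of_cmInert_of_lower'`
(`X12/InertCoreEveryCurveDeuringFree.lean`): the strong member of the class exists by Modularity
(`hnf`), Edixhoven 1991 Thm. 3 (`hEdx`) + Deuring (a tree theorem) make its Manin constant prime
to `p > 7`, Kolyvagin–Matar–Nekovář give its upper half, Cassels (`hCassels`) moves the halves to
`W`, and the typed target supplies the lower half of `W`. CONDITIONAL on the typed target; nothing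
booked. [cite: EdixhovenManin1991, Thm. 3] [cite: MatarNekovar2019, Thm. 0.3 and §0.11]
[cite: MilneADT2006, Thm. I.7.3 and Remark I.7.4] [cite: Lang1987, Ch. 13 §4 Thm. 12] -/
theorem bsdp_of_lowerHalfOnType_of_seven_lt
    (hGZ : ∀ (N : ℕ) [NeZero N] (W : WeierstrassCurve ℚ) (K : Type) [Field K] [NumberField K],
      gross_zagier N W K)
    (hKo : ∀ (N : ℕ) [NeZero N] (W : WeierstrassCurve ℚ) (K : Type) [Field K] [NumberField K],
      kolyvagin N W K)
    (hMN : ∀ (N : ℕ) [NeZero N] (W : WeierstrassCurve ℚ) (K : Type) [Field K] [NumberField K],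
      MatarNekovar2019.thm03_padicValNat_card_sha_le_of_irreducible N W K)
    (hGZK : rank_eq_analyticRank_of_analyticRank_le_one) (hmod : hasEntireLFunction_rat)
    (hnf : exists_isNewformOf) (hFH : friedbergHoffstein_exists_heegnerField_split_twist_ne_zero)
    (hCM8 : bsdTriple_of_hasCM_of_L_one_ne_zero)
    (hEdx : edixhoven_not_dvd_maninConstant_of_not_potentiallyGoodOrdinary)
    (hCassels : bsdRHS_eq_of_isIsogenous) (h : LowerHalfOnType p T)
    (W : WeierstrassCurve ℚ) [W.IsElliptic] [W.IsGloballyMinimal]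
    (hT : HasSignedLocalType W p T) (hr : W.analyticRank = 1) (hp7 : 7 < p) : BSDp W p :=
  bsdp_of_classX12_of_cmInert_of_lower' hGZ hKo hMN hGZK hmod hnf hFH hCM8 hEdx hCassels W p
    (classX12_of_hasSignedLocalType W p hT hr) hp7 (not_cmRamified_of_hasSignedLocalType W p hT)
    (not_cmSplit_of_hasSignedLocalType W p hT) (h W hT hr)

/-- **At `p ≥ 11` the O10 class target on a signed local type is EXACTLY `BSD_p` on the type.**
Given the published named facts of the inert-core assembly (Gross–Zagier, Kolyvagin,
Matar–Nekovář 2019 Thm. 0.3, GZK, modularity, Friedberg–Hoffstein, the rank-0 CM triple,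
Edixhoven 1991 Thm. 3, Cassels): `LowerHalfOnType p T ⟺` (`BSD(W,p)` for every globally
minimal rank-one CM curve `W` of signed local type `(p, T)`). Forward:
`bsdp_of_lowerHalfOnType_of_seven_lt`;
backward: cc-typer-6's `lowerHalfOnType_of_forall_bsdp` (`Ш` finite by GZK). So closing the typed
target on a type at `p ≥ 11` buys `BSD_p` for the whole type with NO auxiliary datum, and nothing
less closes it. Bookkeeping; O10 stays OPEN; nothing booked.
[cite: EdixhovenManin1991, Thm. 3] [cite: MatarNekovar2019, Thm. 0.3 and §0.11]
[cite: Miller2011LMS, §1 and Def. 1.1] -/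
theorem lowerHalfOnType_iff_forall_bsdp_of_seven_lt
    (hGZ : ∀ (N : ℕ) [NeZero N] (W : WeierstrassCurve ℚ) (K : Type) [Field K] [NumberField K],
      gross_zagier N W K)
    (hKo : ∀ (N : ℕ) [NeZero N] (W : WeierstrassCurve ℚ) (K : Type) [Field K] [NumberField K],
      kolyvagin N W K)
    (hMN : ∀ (N : ℕ) [NeZero N] (W : WeierstrassCurve ℚ) (K : Type) [Field K] [NumberField K],
      MatarNekovar2019.thm03_padicValNat_card_sha_le_of_irreducible N W K)
    (hGZK : rank_eq_analyticRank_of_analyticRank_le_one) (hmod : hasEntireLFunction_rat)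
    (hnf : exists_isNewformOf) (hFH : friedbergHoffstein_exists_heegnerField_split_twist_ne_zero)
    (hCM8 : bsdTriple_of_hasCM_of_L_one_ne_zero)
    (hEdx : edixhoven_not_dvd_maninConstant_of_not_potentiallyGoodOrdinary)
    (hCassels : bsdRHS_eq_of_isIsogenous) (hp7 : 7 < p) :
    LowerHalfOnType p T ↔
      ∀ (W : WeierstrassCurve ℚ) [W.IsElliptic] [W.IsGloballyMinimal],
        HasSignedLocalType W p T → W.analyticRank = 1 → BSDp W p :=
  ⟨fun h W _ _ hT hr ↦ bsdp_of_lowerHalfOnType_of_seven_lt hGZ hKo hMN hGZK hmod hnf hFH hCM8 hEdx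
      hCassels h W hT hr hp7,
    lowerHalfOnType_of_forall_bsdp hGZK⟩

/-- **Corollary: at `p ≥ 11`, `BSD(W,p) ⟺ MissingLowerBoundAt W p` for every rank-one CM curve of
signed local type `(p, T)`** — the per-pair form of the previous sentence (x1b's every-curve
`bsdp_iff_missingLowerBoundAt_of_classX12_of_cmInert'` read on the type). Bookkeeping.
[cite: EdixhovenManin1991, Thm. 3] [cite: Miller2011LMS, §1 and Def. 1.1] -/
theorem bsdp_iff_missingLowerBoundAt_of_hasSignedLocalType_of_seven_lt
    (hGZ : ∀ (N : ℕ) [NeZero N] (W : WeierstrassCurve ℚ) (K : Type) [Field K] [NumberField K],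
      gross_zagier N W K)
    (hKo : ∀ (N : ℕ) [NeZero N] (W : WeierstrassCurve ℚ) (K : Type) [Field K] [NumberField K],
      kolyvagin N W K)
    (hMN : ∀ (N : ℕ) [NeZero N] (W : WeierstrassCurve ℚ) (K : Type) [Field K] [NumberField K],
      MatarNekovar2019.thm03_padicValNat_card_sha_le_of_irreducible N W K)
    (hGZK : rank_eq_analyticRank_of_analyticRank_le_one) (hmod : hasEntireLFunction_rat)
    (hnf : exists_isNewformOf) (hFH : friedbergHoffstein_exists_heegnerField_split_twist_ne_zero)
    (hCM8 : bsdTriple_of_hasCM_of_L_one_ne_zero)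
    (hEdx : edixhoven_not_dvd_maninConstant_of_not_potentiallyGoodOrdinary)
    (hCassels : bsdRHS_eq_of_isIsogenous)
    (W : WeierstrassCurve ℚ) [W.IsElliptic] [W.IsGloballyMinimal]
    (hT : HasSignedLocalType W p T) (hr : W.analyticRank = 1) (hp7 : 7 < p) :
    BSDp W p ↔ MissingLowerBoundAt W p :=
  bsdp_iff_missingLowerBoundAt_of_classX12_of_cmInert' hGZ hKo hMN hGZK hmod hnf hFH hCM8 hEdx
    hCassels W p (classX12_of_hasSignedLocalType W p hT hr) hp7
    (not_cmRamified_of_hasSignedLocalType W p hT) (not_cmSplit_of_hasSignedLocalType W p hT)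

end Summit.BirchSwinnertonDyer.Rank1Residual.X12.O10

end
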